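import Mathlib
import HarnessLib
import Summits.HubbardSuperconductivity.HubbardSuperconductivity.Theorems.KLProgrammeH10TwoPointLimitSymbolFrameInstance
import Summits.HubbardSuperconductivity.HubbardSuperconductivity.Theorems.KLProgrammeKLRegimeSymbolFrameProfileThird

/-!
# K3 VL child `KLRegimeVolumeLimitV17F2` (stmt-HubbardSuperconductivity-20440), located item #23 «W2-HALF-VL», brick «W2H-OVL» part 4 (SYMBOL):
# the THIN INCREMENT pair `(F^{K_o}_{n_a,ω_a} − F^{K}_{n_a,ω_a})·F^{K}_{n_b,ω_b}` of `klAnisoFamily` across two frames IS a sampled increment-pair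
# symbol — the `hΦ`/`hGsΦ` of `…ThinMultiplierIncrementPair{Space,Time,Tangent}`; its sup; the split of the thin-pair frame difference into two such pairs

Cell `gate-hubbard-kl`, seat p3 (g14), lead of #23; THIN twin of k3c3-p2's `…FatMultiplierIncrementPairSymbol` (p583067) and of the sup clause of
`…FatMultiplierIncrementPairData`.  The re-analysis increment of the tower's transfer reduces (`klAnisoFamily_mul_bgmFatMultiplier_eq_sum`) to thin-pair
frame differences `D = F^{K_o}_aF^{K_o}_b − F^{K}_aF^{K}_b` (`a = (n_a, ω_a)`, `b = (n_b, ω_b)`, any two scales); with p4's unfolding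
(`klAnisoFamily = C_{−n}⁻¹(√u)·ζ_{n,ω}`, `u = ω² + e_K²`, `C_{−n}⁻¹(√u) = G_n(16ⁿu)`) and p4's thin two-sector angular factor `Z`
(`…H10TwoPointLimitSymbolAngularFactor`):

* §1 `klAniso_mul_klAniso_eq_symbol₂` — the MIXED pair `F^{K_o}_a·F^{K}_b` is the sample of `G_{n_a}(k₀² + e_{K_o}²)·G_{n_b}(k₀² + e_K²)·Z`
  (only the base frame `K` needs the shell hypothesis `e₀ + A − μ ≤ 3`);
* §2 **`klAnisoIncr_mul_klAniso_eq_symbol`** — `F^{K_o}_aF^{K}_b − F^{K}_aF^{K}_b` is the sample of the increment-pair symbol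
  `Φ^Δ = (G_{n_a}(k₀² + (e_K − ν)²) − G_{n_a}(k₀² + e_K²))·(G_{n_b}(k₀² + e_K²)·Z)`, `ν = e_K − e_{K_o}` — LITERALLY the `hΦ`/`hGsΦ` shape of
  `norm_fwdDiff_iter_{space,time,tangent}_thinIncrPair_le`;
* §3 `norm_thinIncrPairSymbol_le` — sup `‖Φ^Δ‖ ≤ (de₀²/Λ_a²)·P₀(2(Λ_a + P₀) + P₀)` (`|ν| ≤ P₀`; every term carries the piece);
* §4 `klAnisoPairDiff_eq_incr_sub_incr` — `F′_aF′_b − F_aF_b = (F′_aF_b − F_aF_b) − (F_bF′_a − F′_bF′_a)`: the frame difference is the increment pair with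
  base `K` (increment in `a`, co-factor `b`) minus the increment pair with base `K′ = K_o` (increment in `b`, co-factor `a`).

Everything is proved; no definitions, no sorry.  Nothing asserts any stub, K3, VL or superconductivity. [cite: BenfattoGiulianiMastropietro2006, §2.5 (2.45)–(2.48), §2.7 (2.66), (2.71a)]
-/

noncomputable section

namespace Summit.HubbardSuperconductivity.HubbardSuperconductivity.Theorems.TorusFourierL2

set_option linter.dupNamespace false -- summit = problem name (single-conjunct summit), D-0017

open Set Finset Literature.MathematicalPhysics.QuantumLattice Literature.MathematicalPhysics.QuantumLattice.BandSectorCounting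
open Literature.MathematicalPhysics.QuantumLattice.FermiRG Literature.Probability.LatticeModels Literature.Analysis.SpecialFunctions
open Summit.HubbardSuperconductivity.HubbardSuperconductivity.Theorems.DispersionFlow
open Summit.HubbardSuperconductivity.HubbardSuperconductivity.Theorems.KLRegimeSplit
open Summit.HubbardSuperconductivity.HubbardSuperconductivity.Theorems.KLProgrammeLegKernels
open Summit.HubbardSuperconductivity.HubbardSuperconductivity.Theorems.PerturbedFermiCurve
open scoped Real Nat

section ThinIncrIdent

open Classical

variable {L M : ℕ} [NeZero L] [NeZero M] {K : TrigPolyC4v} (Ko : TrigPolyC4v) {A : ℝ}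
  (hA : ∀ p : Momentum, ∀ j ≤ 2, ‖iteratedFDeriv ℝ j (frameShift K) p‖ ≤ A)
  {μ e₀ z β : ℝ} (he : 0 < e₀) (hz : 0 < z) (h3 : e₀ + A - μ ≤ 3)
  {na nb : ℕ} (ωa : Fin (sectorCount na)) (ωb : Fin (sectorCount nb))
  {Z : (Fin 2 → ℝ) → ℝ}
  (hZ : ∀ p, Z p = gnCutoff ((π + z) ^ 2 / π ^ 2) ((π + z) ^ 2) (p 0 ^ 2) * gnCutoff ((π + z) ^ 2 / π ^ 2) ((π + z) ^ 2) (p 1 ^ 2) *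
    ((radialCutoffC (1 / 2) (momToComplex p) * sectorWeightCirc na ((ωa : ℕ) : ℤ) (polarAngle p)) *
      (radialCutoffC (1 / 2) (momToComplex p) * sectorWeightCirc nb ((ωb : ℕ) : ℤ) (polarAngle p))))

/-! ## §1 The mixed pair -/

include hA h3 he hz hZ in
/-- **The mixed thin pair IS the sample of the two-frame symbol**: for every product-torus label `q`,
`F^{K_o}_a(k(q))·F^{K}_b(k(q)) = Φ₂(sample point)`, `Φ₂ = G_{n_a}(k₀² + e_{K_o}²)·G_{n_b}(k₀² + e_K²)·Z`; only the base frame `K` needs the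
shell hypothesis `e₀ + A − μ ≤ 3`. [cite: BenfattoGiulianiMastropietro2006, §2.5 (2.45)–(2.48)] -/
theorem klAniso_mul_klAniso_eq_symbol₂ {Φ₂ : ℝ × (Fin 2 → ℝ) → ℂ}
    (hΦ₂ : ∀ k₀ p, Φ₂ (k₀, p) = ((bgmCutoffSq e₀ ((16 : ℝ) ^ na * (k₀ ^ 2 + frameLevel μ Ko (WithLp.toLp 2 p) ^ 2)) *
      bgmCutoffSq e₀ ((16 : ℝ) ^ nb * (k₀ ^ 2 + frameLevel μ K (WithLp.toLp 2 p) ^ 2)) * Z p : ℝ) : ℂ))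
    (q : TorusSite 1 (2 * M) × TorusSite 2 L) :
    klAnisoFamily L M β μ Ko e₀ na ωa (⟨(q.1 0).val, ZMod.val_lt (q.1 0)⟩, q.2) *
        klAnisoFamily L M β μ K e₀ nb ωb (⟨(q.1 0).val, ZMod.val_lt (q.1 0)⟩, q.2) =
      Φ₂ (π * (1 - 2 * M) / β + 2 * π / β * (((q.1 0).val : ℕ) : ℝ), fun j => 2 * π / L * (((q.2 j).valMinAbs : ℤ) : ℝ)) := by
  have hsp := sampledPoint_eq (L := L) (M := M) β q
  rw [← hsp, hΦ₂]
  set k₀ : ℝ := matsubaraFreq β M (⟨(q.1 0).val, ZMod.val_lt (q.1 0)⟩ : MatsubaraIdx M) with hk₀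
  set c : Fin 2 → ℝ := torusCentredMomentum L q.2 with hc
  have he_eq : nambuXiCT L μ K q.2 = frameLevel μ K (WithLp.toLp 2 c) := nambuXiCT_eq_frameLevel L μ K q.2
  have heo_eq : nambuXiCT L μ Ko q.2 = frameLevel μ Ko (WithLp.toLp 2 c) := nambuXiCT_eq_frameLevel L μ Ko q.2
  have hang : momentumAngle L q.2 = polarAngle c := rfl
  set u : ℝ := k₀ ^ 2 + frameLevel μ K (WithLp.toLp 2 c) ^ 2 with hu
  set uo : ℝ := k₀ ^ 2 + frameLevel μ Ko (WithLp.toLp 2 c) ^ 2 with huo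
  -- unfold the two multipliers
  have hFa : klAnisoFamily L M β μ Ko e₀ na ωa (⟨(q.1 0).val, ZMod.val_lt (q.1 0)⟩, q.2) =
      ((gnScaleCutoff 4 e₀ (-(na : ℤ)) (Real.sqrt uo) * sectorWeightCirc na ((ωa : ℕ) : ℤ) (polarAngle c) : ℝ) : ℂ) := by
    rw [klAnisoFamily, bgmMultiplier, heo_eq, hang]
  have hFb : klAnisoFamily L M β μ K e₀ nb ωb (⟨(q.1 0).val, ZMod.val_lt (q.1 0)⟩, q.2) =
      ((gnScaleCutoff 4 e₀ (-(nb : ℤ)) (Real.sqrt u) * sectorWeightCirc nb ((ωb : ℕ) : ℤ) (polarAngle c) : ℝ) : ℂ) := by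
    rw [klAnisoFamily, bgmMultiplier, he_eq, hang]
  rw [hFa, hFb, ← Complex.ofReal_mul]
  congr 1
  -- the square cutoff is `1` at the sample point
  have hcπ : ∀ j, |c j| ≤ π := abs_torusCentredMomentum_le_pi L q.2
  have hsq : ∀ j, gnCutoff ((π + z) ^ 2 / π ^ 2) ((π + z) ^ 2) (c j ^ 2) = 1 := fun j =>
    sqCutoff_eq_one hz (by rw [← sq_abs]; exact pow_le_pow_left₀ (abs_nonneg _) (hcπ j) 2)
  rw [hZ c, hsq 0, hsq 1, one_mul, one_mul]
  by_cases hR : (1 : ℝ) / 2 ≤ ‖momToComplex c‖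
  · -- plateau `= 1`: the identity holds factor by factor
    rw [radialCutoffC_eq_one (by norm_num) hR, one_mul, one_mul, gnScaleCutoff_sqrt_eq_bgmCutoffSq, gnScaleCutoff_sqrt_eq_bgmCutoffSq]
    ring
  · -- inside the Fermi region's complement the base factor vanishes on both sides
    have hnot : ¬ (1 : ℝ) ≤ ‖momToComplex c‖ := fun h1 => hR (by linarith)
    have hbig : e₀ < |frameLevel μ K (WithLp.toLp 2 c)| := by
      by_contra hle
      exact hnot (one_le_norm_of_frameBand_le hA h3 (not_lt.1 hle))
    have h1 : gnScaleCutoff 4 e₀ (-(nb : ℤ)) (Real.sqrt u) = 0 := gnScaleCutoff_eq_zero_of_band_gt he nb hbig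
    have h1' : bgmCutoffSq e₀ ((16 : ℝ) ^ nb * u) = 0 := by rw [← gnScaleCutoff_sqrt_eq_bgmCutoffSq]; exact h1
    rw [h1, h1']; ring

/-! ## §2 The increment pair -/

include hA h3 he hz hZ in
/-- **The thin INCREMENT pair IS the sample of the increment-pair symbol**: with `ν = e_K − e_{K_o}` (so `e_{K_o} = e_K − ν`),
`F^{K_o}_a(k(q))·F^{K}_b(k(q)) − F^{K}_a(k(q))·F^{K}_b(k(q)) = Φ^Δ(sample point)`,
`Φ^Δ = (G_{n_a}(k₀² + (e_K − ν)²) − G_{n_a}(k₀² + e_K²))·(G_{n_b}(k₀² + e_K²)·Z)` — the `hΦ`/`hGsΦ` shape of `norm_fwdDiff_iter_space_thinIncrPair_le`.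
[cite: BenfattoGiulianiMastropietro2006, §2.5 (2.45)–(2.48), §2.7 (2.71a)] -/
theorem klAnisoIncr_mul_klAniso_eq_symbol {ν : (Fin 2 → ℝ) → ℝ} (hν : ∀ p, ν p = frameLevel μ K (WithLp.toLp 2 p) - frameLevel μ Ko (WithLp.toLp 2 p))
    {Φ : ℝ × (Fin 2 → ℝ) → ℂ}
    (hΦ : ∀ k₀ p, Φ (k₀, p) = (((bgmCutoffSq e₀ ((16 : ℝ) ^ na * (k₀ ^ 2 + (frameLevel μ K (WithLp.toLp 2 p) - ν p) ^ 2)) -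
      bgmCutoffSq e₀ ((16 : ℝ) ^ na * (k₀ ^ 2 + frameLevel μ K (WithLp.toLp 2 p) ^ 2))) *
      (bgmCutoffSq e₀ ((16 : ℝ) ^ nb * (k₀ ^ 2 + frameLevel μ K (WithLp.toLp 2 p) ^ 2)) * Z p) : ℝ) : ℂ))
    (q : TorusSite 1 (2 * M) × TorusSite 2 L) :
    klAnisoFamily L M β μ Ko e₀ na ωa (⟨(q.1 0).val, ZMod.val_lt (q.1 0)⟩, q.2) *
        klAnisoFamily L M β μ K e₀ nb ωb (⟨(q.1 0).val, ZMod.val_lt (q.1 0)⟩, q.2) -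
      klAnisoFamily L M β μ K e₀ na ωa (⟨(q.1 0).val, ZMod.val_lt (q.1 0)⟩, q.2) *
        klAnisoFamily L M β μ K e₀ nb ωb (⟨(q.1 0).val, ZMod.val_lt (q.1 0)⟩, q.2) =
      Φ (π * (1 - 2 * M) / β + 2 * π / β * (((q.1 0).val : ℕ) : ℝ), fun j => 2 * π / L * (((q.2 j).valMinAbs : ℤ) : ℝ)) := by
  -- the two-frame symbol and the plain symbol
  obtain ⟨Φ₂, hΦ₂⟩ : ∃ Φ₂ : ℝ × (Fin 2 → ℝ) → ℂ, Φ₂ = fun x => ((bgmCutoffSq e₀ ((16 : ℝ) ^ na * (x.1 ^ 2 + frameLevel μ Ko (WithLp.toLp 2 x.2) ^ 2)) *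
      bgmCutoffSq e₀ ((16 : ℝ) ^ nb * (x.1 ^ 2 + frameLevel μ K (WithLp.toLp 2 x.2) ^ 2)) * Z x.2 : ℝ) : ℂ) := ⟨_, rfl⟩
  obtain ⟨Φ₁, hΦ₁⟩ : ∃ Φ₁ : ℝ × (Fin 2 → ℝ) → ℂ, Φ₁ = fun x => ((bgmCutoffSq e₀ ((16 : ℝ) ^ na * (x.1 ^ 2 + frameLevel μ K (WithLp.toLp 2 x.2) ^ 2)) *
      bgmCutoffSq e₀ ((16 : ℝ) ^ nb * (x.1 ^ 2 + frameLevel μ K (WithLp.toLp 2 x.2) ^ 2)) * Z x.2 : ℝ) : ℂ) := ⟨_, rfl⟩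
  have hΦ₂' : ∀ k₀ p, Φ₂ (k₀, p) = ((bgmCutoffSq e₀ ((16 : ℝ) ^ na * (k₀ ^ 2 + frameLevel μ Ko (WithLp.toLp 2 p) ^ 2)) *
      bgmCutoffSq e₀ ((16 : ℝ) ^ nb * (k₀ ^ 2 + frameLevel μ K (WithLp.toLp 2 p) ^ 2)) * Z p : ℝ) : ℂ) := fun k₀ p => by rw [hΦ₂]
  have hΦ₁' : ∀ k₀ p, Φ₁ (k₀, p) = ((bgmCutoffSq e₀ ((16 : ℝ) ^ na * (k₀ ^ 2 + frameLevel μ K (WithLp.toLp 2 p) ^ 2)) *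
      bgmCutoffSq e₀ ((16 : ℝ) ^ nb * (k₀ ^ 2 + frameLevel μ K (WithLp.toLp 2 p) ^ 2)) * Z p : ℝ) : ℂ) := fun k₀ p => by rw [hΦ₁]
  rw [klAniso_mul_klAniso_eq_symbol₂ Ko hA he hz h3 ωa ωb hZ hΦ₂' q, klAniso_mul_klAniso_eq_symbol hA he hz h3 ωa ωb hZ hΦ₁' q,
    hΦ₂', hΦ₁', hΦ]
  have hsub : ∀ p : Fin 2 → ℝ, frameLevel μ K (WithLp.toLp 2 p) - ν p = frameLevel μ Ko (WithLp.toLp 2 p) := fun p => by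
    rw [hν p]; ring
  rw [hsub]
  push_cast
  ring

/-! ## §3 The sup of the increment-pair symbol -/

omit [NeZero L] [NeZero M] in
include he hZ in
/-- **Sup of the increment-pair symbol**: `‖Φ^Δ(k₀, p)‖ ≤ (de₀²/Λ_a²)·P₀(2(Λ_a + P₀) + P₀)` whenever `|ν| ≤ P₀` (`Λ_a = klScale e₀ n_a`; the mean value
theorem for `G_{n_a}` on the shell, both profiles vanishing off it; `|G_{n_b}·Z| ≤ 1`). [cite: BenfattoGiulianiMastropietro2006, §2.7 (2.66), §3 (3.2)] -/
theorem norm_thinIncrPairSymbol_le {d : ℝ} (hd1 : ∀ u, |deriv (bgmCutoffSq e₀) u| ≤ d) (hd2 : ∀ u, |iteratedDeriv 2 (bgmCutoffSq e₀) u| ≤ d)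
    (hd3 : ∀ u, |iteratedDeriv 3 (bgmCutoffSq e₀) u| ≤ d)
    {ν : (Fin 2 → ℝ) → ℝ} {P₀ : ℝ} (hN₀ : ∀ p, |ν p| ≤ P₀)
    {Φ : ℝ × (Fin 2 → ℝ) → ℂ}
    (hΦ : ∀ k₀ p, Φ (k₀, p) = (((bgmCutoffSq e₀ ((16 : ℝ) ^ na * (k₀ ^ 2 + (frameLevel μ K (WithLp.toLp 2 p) - ν p) ^ 2)) -
      bgmCutoffSq e₀ ((16 : ℝ) ^ na * (k₀ ^ 2 + frameLevel μ K (WithLp.toLp 2 p) ^ 2))) *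
      (bgmCutoffSq e₀ ((16 : ℝ) ^ nb * (k₀ ^ 2 + frameLevel μ K (WithLp.toLp 2 p) ^ 2)) * Z p) : ℝ) : ℂ))
    (k₀ : ℝ) (p : Fin 2 → ℝ) :
    ‖Φ (k₀, p)‖ ≤ d * e₀ ^ 2 / klScale e₀ na ^ 2 * (P₀ * (2 * (klScale e₀ na + P₀) + P₀)) := by
  have hΛ : 0 < klScale e₀ na := by rw [klScale]; positivity
  have hP0 : 0 ≤ P₀ := (abs_nonneg _).trans (hN₀ 0)
  have hd0 : 0 ≤ d := (abs_nonneg _).trans (hd1 0)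
  set eK : (Fin 2 → ℝ) → ℝ := fun p => frameLevel μ K (WithLp.toLp 2 p) with heK
  set G : ℝ → ℝ := fun u => bgmCutoffSq e₀ ((16 : ℝ) ^ na * u) with hGdef
  obtain ⟨hGc, hG0, hG1, -, -, hGv⟩ := scaleProfile_bounds₃ he na hd1 hd2 hd3
  have hZ1 : ∀ p, |Z p| ≤ 1 := abs_angularFactor_le_one hZ
  have hGdiff : ∀ x y : ℝ, ‖G y - G x‖ ≤ d * e₀ ^ 2 / klScale e₀ na ^ 2 * ‖y - x‖ := by
    intro x y
    refine Convex.norm_image_sub_le_of_norm_deriv_le (s := Set.univ) (fun u _ => (hGc.differentiable (by norm_num) u)) ?_ convex_univ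
      (Set.mem_univ x) (Set.mem_univ y)
    intro u _; rw [Real.norm_eq_abs]; exact hG1 u
  have hC₁ : 0 ≤ d * e₀ ^ 2 / klScale e₀ na ^ 2 := by positivity
  rw [hΦ, Complex.norm_real, Real.norm_eq_abs, abs_mul, abs_mul]
  have hQle : |bgmCutoffSq e₀ ((16 : ℝ) ^ nb * (k₀ ^ 2 + frameLevel μ K (WithLp.toLp 2 p) ^ 2))| * |Z p| ≤ 1 :=
    le_trans (mul_le_mul (abs_bgmCutoffSq_le_one e₀ _) (hZ1 p) (abs_nonneg _) zero_le_one) (le_of_eq (one_mul _))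
  have hQ0 : 0 ≤ |bgmCutoffSq e₀ ((16 : ℝ) ^ nb * (k₀ ^ 2 + frameLevel μ K (WithLp.toLp 2 p) ^ 2))| * |Z p| := by positivity
  -- the increment factor
  have hI : |bgmCutoffSq e₀ ((16 : ℝ) ^ na * (k₀ ^ 2 + (frameLevel μ K (WithLp.toLp 2 p) - ν p) ^ 2)) -
      bgmCutoffSq e₀ ((16 : ℝ) ^ na * (k₀ ^ 2 + frameLevel μ K (WithLp.toLp 2 p) ^ 2))| ≤
      d * e₀ ^ 2 / klScale e₀ na ^ 2 * (P₀ * (2 * (klScale e₀ na + P₀) + P₀)) := by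
    by_cases hfar : klScale e₀ na + P₀ < |eK p|
    · -- both arguments exceed `Λ²`
      have h1 : klScale e₀ na < |eK p| := by linarith only [hfar, hP0]
      have h2 : klScale e₀ na < |eK p - ν p| := by
        have := abs_sub_abs_le_abs_sub (eK p) (ν p); linarith only [this, hfar, hN₀ p]
      have sq1 : klScale e₀ na ^ 2 < k₀ ^ 2 + eK p ^ 2 := by
        have h := pow_lt_pow_left₀ h1 hΛ.le two_ne_zero
        rw [sq_abs] at h; exact lt_of_lt_of_le h (le_add_of_nonneg_left (sq_nonneg k₀))
      have sq2 : klScale e₀ na ^ 2 < k₀ ^ 2 + (eK p - ν p) ^ 2 := by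
        have h := pow_lt_pow_left₀ h2 hΛ.le two_ne_zero
        rw [sq_abs] at h; exact lt_of_lt_of_le h (le_add_of_nonneg_left (sq_nonneg k₀))
      have z1 : bgmCutoffSq e₀ ((16 : ℝ) ^ na * (k₀ ^ 2 + frameLevel μ K (WithLp.toLp 2 p) ^ 2)) = 0 := hGv _ sq1
      have z2 : bgmCutoffSq e₀ ((16 : ℝ) ^ na * (k₀ ^ 2 + (frameLevel μ K (WithLp.toLp 2 p) - ν p) ^ 2)) = 0 := hGv _ sq2
      rw [z1, z2, sub_zero, abs_zero]; positivity
    · have hnear : |eK p| ≤ klScale e₀ na + P₀ := not_lt.1 hfar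
      have hW : ‖(k₀ ^ 2 + (eK p - ν p) ^ 2) - (k₀ ^ 2 + eK p ^ 2)‖ ≤ P₀ * (2 * (klScale e₀ na + P₀) + P₀) := by
        rw [Real.norm_eq_abs, show (k₀ ^ 2 + (eK p - ν p) ^ 2) - (k₀ ^ 2 + eK p ^ 2) = -(ν p * (2 * eK p - ν p)) by ring, abs_neg, abs_mul]
        refine mul_le_mul (hN₀ p) ((abs_sub _ _).trans ?_) (abs_nonneg _) hP0
        rw [abs_mul, abs_two]; linarith only [hN₀ p, hnear]
      have h := hGdiff (k₀ ^ 2 + eK p ^ 2) (k₀ ^ 2 + (eK p - ν p) ^ 2)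
      rw [Real.norm_eq_abs] at h
      exact h.trans (mul_le_mul_of_nonneg_left hW hC₁)
  calc _ ≤ d * e₀ ^ 2 / klScale e₀ na ^ 2 * (P₀ * (2 * (klScale e₀ na + P₀) + P₀)) * 1 :=
        mul_le_mul hI hQle hQ0 (by positivity)
    _ = _ := mul_one _

/-! ## §4 The split of the frame difference into two increment pairs -/

omit [NeZero L] [NeZero M] in
/-- **The frame difference of a thin pair is a difference of two increment pairs** (pointwise, pure algebra): with `F′ = F^{K_o}`, `F = F^{K}`,
`F′_aF′_b − F_aF_b = (F′_aF_b − F_aF_b) − (F_bF′_a − F′_bF′_a)` — base `K` with the increment in `a`, minus base `K_o` with the increment in `b`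
(each bracket is the literal left-hand side of `klAnisoIncr_mul_klAniso_eq_symbol`). [cite: BenfattoGiulianiMastropietro2006, §2.7 (2.71a)] -/
theorem klAnisoPairDiff_eq_incr_sub_incr (k : FreqMomentum L M) :
    klAnisoFamily L M β μ Ko e₀ na ωa k * klAnisoFamily L M β μ Ko e₀ nb ωb k -
        klAnisoFamily L M β μ K e₀ na ωa k * klAnisoFamily L M β μ K e₀ nb ωb k =
      (klAnisoFamily L M β μ Ko e₀ na ωa k * klAnisoFamily L M β μ K e₀ nb ωb k -
          klAnisoFamily L M β μ K e₀ na ωa k * klAnisoFamily L M β μ K e₀ nb ωb k) -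
        (klAnisoFamily L M β μ K e₀ nb ωb k * klAnisoFamily L M β μ Ko e₀ na ωa k -
          klAnisoFamily L M β μ Ko e₀ nb ωb k * klAnisoFamily L M β μ Ko e₀ na ωa k) := by
  ring

end ThinIncrIdent

end Summit.HubbardSuperconductivity.HubbardSuperconductivity.Theorems.TorusFourierL2

end
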